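import Summits.HodgeConjecture.HodgeConjecture.Theorems.PgOneCyclotomicSquares
import Literature.AlgebraicGeometry.Surfaces.K3PeriodSurjectivity

/-!
# Route MarkmanPartnerTransport · crux `PicardThreeK3Squares` (stmt-HodgeConjecture-19652) —
# the CYCLOTOMIC-CM sub-sector WITHOUT Buskin's theorem: marked projective K3 surfaces with a
# self-map acting on the period by a primitive `n`-th root of unity and `ρ(S) + φ(n) = 22`

The CM third of the crux (`End_Hdg(T(S))` a CM field) is in the tree only CONDITIONALLY: every CM
K3 square goes through the named fact `Surfaces.Buskin2019_hodgeIsometry_algebraic` (twistor lines ∕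
hyperholomorphic sheaves; `CMThird.hodgeConjectureFor_square_of_CM_of_buskin`). This file records the
first UNCONDITIONAL piece of that third, in the crux's own vocabulary (the `let MarkedK3 := …` binder of
`PicardThreeK3Squares`, VERBATIM): if a marked projective K3 surface `(S, η, p, x)` carries a self-map
`τ : S ⟶ S` (any endomorphism — an automorphism in practice) with `τ^*(η⁻¹x) = ζ · η⁻¹x` for a
PRIMITIVE `n`-th root of unity `ζ` and `ρ(S) + φ(n) = 22`, then `HodgeConjectureFor 4 (S ⊗ S)` — by the
KERNEL rung `PgOneCyclotomicSquares.hodgeConjectureFor_square_of_cyclotomicSelfMap` (`End_Hdg(T(S)) =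
ℚ[τ^*] ≅ ℚ(ζ_n)` is spanned by pull-backs, whose graphs are algebraic), no named fact. The sublocus is
the (finite, non-empty, classified) set of K3 surfaces with a purely non-symplectic automorphism of order
`n` and `rk T(S) = φ(n)`: Kondō's six with unimodular `T` (`n ∈ {66, 44, 42, 36, 28, 12}`), Vorontsov ∕
Machida–Oguiso ∕ Oguiso–Zhang (`n ∈ {3^k, 5^k, 7, 11, 13, 17, 19, …}`); those with `ρ(S) = 22 − φ(n) ≥ 3`
(all but `n = 66, 44, 50, 25` …) are instances of the crux.

* `hodgeConjectureFor_square_of_marked_cyclotomicSelfMap` — the marked statement above.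
* `picardThreeK3Squares_restricted_to_cyclotomicSelfMaps` — the crux's universally quantified shape with
  the extra binder "`S` carries such a `τ`", proved outright (no `3 ≤ ρ` needed).

No definition, no named-fact hypothesis, no sorry. Prover seat hodge-nonav-19652-p1 g4
(`--supports stmt-HodgeConjecture-19652`).

References: Kondō, J. Math. Soc. Japan 44 (1992) Main Thm.; Machida–Oguiso, J. Math. Sci. Univ. Tokyo 5
(1998); Oguiso–Zhang, Proc. AMS 128 (2000); Huybrechts, *Lectures on K3 surfaces* Ch. 15 Cor. 1.14,
Ch. 3 Cor. 3.6; Ramón Marí, Collect. Math. 59 (2008) Thm. 3.3; Buskin, J. reine angew. Math. 755 (2019).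
-/

set_option linter.dupNamespace false

noncomputable section

namespace Summit.HodgeConjecture.HodgeConjecture.Theorems.MarkmanPartnerTransport.CyclotomicCM

open CategoryTheory MonoidalCategory
open Literature.AlgebraicGeometry Literature.AlgebraicGeometry.Motives Literature.AlgebraicGeometry.HodgeTheory
open Literature.AlgebraicGeometry.Surfaces
open Literature.AlgebraicTopology.SingularHomology

variable {S : SchemeOver ℂ}

/-- `MarkedK3[S, η, p, x]`: VERBATIM the `let MarkedK3 := …` binder of the route declaration
`PicardThreeK3Squares`. Local notation only. -/
local notation3 (prettyPrint := false) "MarkedK3[" S ", " η ", " p ", " x "]" =>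
  (p ≠ 0 ∧ (IsIntegralClass p ∧
    (∀ q : complexBetti S (2 * 2), IsIntegralClass q → ∃ n : ℤ, q = n • p) ∧
    (∀ c : complexBetti S (2 * 1), IsIntegralClass c ↔ ∃ v : K3Index → ℤ, η c = fun i => (v i : ℂ)) ∧
    (∀ a b : complexBetti S (2 * 1),
      cupProduct (rfl : 2 * 1 + 2 * 1 = 2 * 2) a b = k3Form (η a) (η b) • p) ∧
    IsOfHodgeType 2 S (2 * 1) 2 0 (LinearEquiv.symm η x) ∧
    (∀ τ : complexBetti S (2 * 1), IsOfHodgeType 2 S (2 * 1) 2 0 τ →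
      ∃ t : ℂ, τ = t • LinearEquiv.symm η x)) ∧
    (k3Form x x = 0 ∧ 0 < (k3Form (star x) x).re ∧
      ∃ u : K3Index → ℤ, k3Form (fun i => (u i : ℂ)) x = 0 ∧ 0 < ∑ i, ∑ j, u i * k3Gram i j * u j))

/-- A marking gives `b₂(S) = 22`: `η : H²(S(ℂ); ℂ) ≃ ℂ^{Λ_K3}` and `rk Λ_K3 = 22`. -/
theorem finrank_complexBetti_two_of_marking (η : complexBetti S (2 * 1) ≃ₗ[ℂ] (K3Index → ℂ)) :
    Module.finrank ℂ (complexBetti S (2 * 1)) = 22 := by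
  rw [η.finrank_eq, Module.finrank_fintype_fun_eq_card]
  rfl

/-- The period of a marking is non-zero: `(x̄.x) > 0`. -/
theorem period_ne_zero {η : complexBetti S (2 * 1) ≃ₗ[ℂ] (K3Index → ℂ)} {p : complexBetti S (2 * 2)}
    {x : K3Index → ℂ} (hM : MarkedK3[S, η, p, x]) : LinearEquiv.symm η x ≠ 0 := by
  obtain ⟨-, -, -, hpos, -⟩ := hM
  intro h0
  have hx : x = 0 := by simpa using congrArg η h0
  rw [hx] at hpos
  simp only [k3Form, Pi.zero_apply, mul_zero, Finset.sum_const_zero, Complex.zero_re, lt_self_iff_false]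
    at hpos

/-- **The cyclotomic-CM sub-sector of the crux, unconditionally.** For a marked projective K3 surface
`(S, η, p, x)` (the crux's clauses) with a self-map `τ : S ⟶ S` such that `τ^*(η⁻¹x) = ζ · η⁻¹x`, `ζ` a
primitive `n`-th root of unity (`0 < n`), and `ρ(S) + φ(n) = 22`: `HodgeConjectureFor 4 (S ⊗ S)`. On
`T(S)_ℂ = (N¹H²)^⊥` every Hodge endomorphism is `Σ_{k<n} b_k (τ^k)^*`, `b_k ∈ ℚ`
(`PgOneCyclotomicSquares.hodgeEndomorphisms_eq_sum_pullbacks_of_cyclotomic`), and graphs of self-maps are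
algebraic (`PgOneCyclotomicSquares.hodgeConjectureFor_square_of_endomorphisms`). No Buskin, no marking
fact, no `b₂ = 22` fact (read off `η`). [cite: Kondo1992TrivialOnPicard, Main Theorem]
[cite: Huybrechts2016K3, Ch. 15 Cor. 1.14 and Ch. 3 Cor. 3.6] [cite: RamonMari2008, Thm. 3.3] -/
theorem hodgeConjectureFor_square_of_marked_cyclotomicSelfMap (hK3 : IsK3Surface S)
    {η : complexBetti S (2 * 1) ≃ₗ[ℂ] (K3Index → ℂ)} {p : complexBetti S (2 * 2)} {x : K3Index → ℂ}
    (hM : MarkedK3[S, η, p, x]) (τ : S ⟶ S) {n : ℕ} (hn : 0 < n) {ζ : ℂ} (hζ : IsPrimitiveRoot ζ n)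
    (heig : complexBetti.map τ (2 * 1) (LinearEquiv.symm η x) = ζ • LinearEquiv.symm η x)
    (hρ : Module.finrank ℂ (algebraicClasses S 1) + Nat.totient n = 22) :
    HodgeConjectureFor 4 (S ⊗ S) :=
  PgOneCyclotomicSquares.hodgeConjectureFor_square_of_cyclotomicSelfMap hK3.isSmoothProjective
    hM.2.1.2.2.2.2.1 (period_ne_zero hM) hM.2.1.2.2.2.2.2 τ hn hζ heig
    (by rw [finrank_complexBetti_two_of_marking η]; exact hρ)

/-- **The crux restricted to the cyclotomic-CM sublocus holds — with no hypothesis on `ρ(S)` beyond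
`ρ(S) + φ(n) = 22` and no named fact.** VERBATIM the binders of `PicardThreeK3Squares` (marked projective
K3 surfaces), plus «`S` carries a self-map acting on the period `η⁻¹x` by a primitive `n`-th root of unity
with `ρ(S) + φ(n) = 22`». [cite: Kondo1992TrivialOnPicard, Main Theorem] [cite: Huybrechts2016K3, Ch. 15 Cor. 1.14] -/
theorem picardThreeK3Squares_restricted_to_cyclotomicSelfMaps :
    ∀ (S : SchemeOver ℂ), IsK3Surface S →
      ∀ (η : complexBetti S (2 * 1) ≃ₗ[ℂ] (K3Index → ℂ)) (p : complexBetti S (2 * 2)) (x : K3Index → ℂ),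
        MarkedK3[S, η, p, x] →
        ∀ (τ : S ⟶ S) (n : ℕ) (ζ : ℂ), 0 < n → IsPrimitiveRoot ζ n →
          complexBetti.map τ (2 * 1) (LinearEquiv.symm η x) = ζ • LinearEquiv.symm η x →
          Module.finrank ℂ (algebraicClasses S 1) + Nat.totient n = 22 →
          HodgeConjectureFor 4 (S ⊗ S) :=
  fun _ hK3 _ _ _ hM τ _ _ hn hζ heig hρ ↦
    hodgeConjectureFor_square_of_marked_cyclotomicSelfMap hK3 hM τ hn hζ heig hρ

end Summit.HodgeConjecture.HodgeConjecture.Theorems.MarkmanPartnerTransport.CyclotomicCM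

end
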